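import Summits.SmoothPoincare4.SmoothPoincare4.Theorems.SymplecticOrigamiGromovRecognitionRelEndHelperNormalWitnessTransfer

/-!
# Split piece `AdjunctionEmbeddedSpheres` (crux stmt-SmoothPoincare4-16775): the birth stub
`stub_normalWitnessTransfer` is PROVED

The birth skeleton `Cruxes/GromovRecognitionRelEnd/SplitAdjunctionBirth.lean` of the split piece
`AdjunctionEmbeddedSpheres` (Wendl 2018 Cor. 2.52 / Thm. 2.51 in two-chart form) registered two stubs on item
stmt-SmoothPoincare4-16775: `stub_wendlEmbeddedness` (C1, XL) and `stub_normalWitnessTransfer` (C2). This file proves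
C2 — a trivial-normal-bundle witness (`N`, submersion `π` cutting the sphere out) transfers from an embedded two-chart
sphere to any EMBEDDED two-chart sphere with homotopic glued map — VERBATIM, by the registered helper
`helper_normalWitnessTransfer` of the parent crux's line `cross-cap-laurent` (`…HelperNormalWitnessTransfer.lean`,
lead c7 of stmt-SmoothPoincare4-11009). C2 is also, verbatim, the support item `SullivanDual.NormalWitnessTransfer`
(stmt-SmoothPoincare4-18059). The proof is Kirby's transport argument (Kirby 1989, Ch. VIII, Thm. 2): in a
Whitney picture of an open submanifold the normal plane field of the new sphere extends to a plane field over the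
ambient piece; the pushed-off fibre of the witness meets the new sphere with vanishing signed count, so the local
indices of the tautological section sum to zero, the plane field has a nowhere-zero section over the push-off, and
transport along the homotopy gives a nowhere-zero normal section, whence a tubular witness.
What remains open in the piece is C1 (`stub_wendlEmbeddedness`, XL: adjunction inequality for `J`-curves).

References: R. Kirby, *The Topology of 4-Manifolds*, LNM 1374 (1989), Ch. VIII Thm. 2; J. Lee, *Introduction to
Smooth Manifolds* (2013), Thm. 6.24; C. Wendl, LNM 2216 (2018), Cor. 2.52. No new definitions, notation or instances.
-/

open scoped Manifold ContDiff Topology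
open Set Function Literature.Topology.FourManifolds Literature.Topology.FourManifolds.ComplexProjectiveSpace
open Literature.Geometry.Symplectic

-- the prescribed namespace `Summit.<P>.<Sub>.…` duplicates `SmoothPoincare4` (P = Sub)
set_option linter.dupNamespace false

namespace Summit.SmoothPoincare4.SmoothPoincare4.Theorems.AdjunctionEmbeddedSpheres

/-- **Birth stub `stub_normalWitnessTransfer` of the split piece `AdjunctionEmbeddedSpheres` (C2; Lee 2013
Thm. 6.24 + Kirby 1989 Ch. VIII Thm. 2): a trivial-normal-bundle witness transfers along a homotopy of embedded
two-chart spheres.** Verbatim the registered signature; by `helper_normalWitnessTransfer`. -/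
theorem stub_normalWitnessTransfer : ∀ (X : Type) [TopologicalSpace X] [T2Space X] [SecondCountableTopology X] [ChartedSpace (EuclideanSpace ℝ (Fin 4)) X] [IsManifold (𝓡 4) ∞ X] (_JX : AlmostComplexStructure (𝓡 4) ∞ X) (u₀ v₀ : ℂ → X) (N : Set X) (π : X → ℂ) (u v : ℂ → X) (F F₀ : C(ComplexProjectiveSpace 1, X)), ContMDiff 𝓘(ℝ, ℂ) (𝓡 4) ∞ u₀ → ContMDiff 𝓘(ℝ, ℂ) (𝓡 4) ∞ v₀ → (∀ z : ℂ, z ≠ 0 → v₀ z = u₀ z⁻¹) → Injective u₀ → (∀ z, Injective (mfderiv 𝓘(ℝ, ℂ) (𝓡 4) u₀ z)) → Injective (mfderiv 𝓘(ℝ, ℂ) (𝓡 4) v₀ 0) → v₀ 0 ∉ range u₀ → IsOpen N → range u₀ ∪ {v₀ 0} ⊆ N → ContMDiffOn (𝓡 4) 𝓘(ℝ, ℂ) ∞ π N → (∀ y ∈ N, Surjective (mfderiv (𝓡 4) 𝓘(ℝ, ℂ) π y)) → {y | y ∈ N ∧ π y = 0} = range u₀ ∪ {v₀ 0} → ContMDiff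 𝓘(ℝ, ℂ) (𝓡 4) ∞ u → ContMDiff 𝓘(ℝ, ℂ) (𝓡 4) ∞ v → (∀ z : ℂ, z ≠ 0 → v z = u z⁻¹) → Injective u → (∀ z, Injective (mfderiv 𝓘(ℝ, ℂ) (𝓡 4) u z)) → Injective (mfderiv 𝓘(ℝ, ℂ) (𝓡 4) v 0) → v 0 ∉ range u → (∀ p, CoordNeZero 0 p → F p = u (affineCoordComplex 0 p 0)) → (∀ p, CoordNeZero 1 p → F p = v (affineCoordComplex 1 p 0)) → (∀ p, CoordNeZero 0 p → F₀ p = u₀ (affineCoordComplex 0 p 0)) → (∀ p, CoordNeZero 1 p → F₀ p = v₀ (affineCoordComplex 1 p 0)) → F.Homotopic F₀ → ∃ (N' : Set X) (π' : X → ℂ), IsOpen N' ∧ range u ∪ {v 0} ⊆ N' ∧ ContMDiffOn (𝓡 4) 𝓘(ℝ, ℂ) ∞ π' N' ∧ (∀ y ∈ N', Surjective (mfderiv (𝓡 4) 𝓘(ℝ, ℂ) π' y)) ∧ {y | y ∈ N' ∧ π' y = 0} = range u ∪ {v 0} :=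
  Summit.SmoothPoincare4.SmoothPoincare4.Theorems.GromovRecognitionRelEnd.CrossCapLaurent.helper_normalWitnessTransfer

end Summit.SmoothPoincare4.SmoothPoincare4.Theorems.AdjunctionEmbeddedSpheres
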